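import Summits.ABC.ABC.Theorems.CongruentialReceptacleTameLocalReceptacleDefs
import Summits.ABC.ABC.Theorems.CongruentialReceptacleTameLocalReceptacleStubFalseOfNearResidueFree
import Summits.ABC.ABC.Theorems.CongruentialReceptacleTameLocalReceptacleStubNearResidueFreeOfPinning

/-!
# Crux `TameLocalReceptacle` (stmt-ABC-14354) is FALSE modulo the ternary-smooth pinning hypothesis

Negative lemma of line `SketchIdeator1` (idea `ternary-smooth-pinning`; lead `prover-line-stmt-ABC-14354-0`),
the composition of its checked skeleton `Cruxes/TameLocalReceptacle/Lines/SketchIdeator1.lean` with every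
stub landed except the analytic input EH:

* `stub_tlr_iff_itr` (Defs file) — the crux ⇔ the single-table receptacle `IntegerTameReceptacle`
  (compactness; the modulus `ℓⁿ` and `ℓ ∤ abc` carry no content);
* `stub_nearResidueFree_of_pinning` — EH (`PinningFamilies κ A`) pins every bounded single table to a
  residue-free one up to `2c₃ + c₁'A` on occurring data;
* `stub_false_of_nearResidueFree` — UNCONDITIONAL: no near-residue-free table with the lower window
  (`ε < 2`) is bounded on the `2⁻²⁵`-cell (three-triple fourth-power certificate with ω-slack).

Hence `PinningHypothesis → ¬ TameLocalReceptacle`, where `PinningHypothesis := ∃ A, PinningFamilies (1/2^25) A`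
is EH at balance `2⁻²⁵` (landed `--negative-modulo PinningHypothesis`; the crux item stays open: EH —
ternary-friable equidistribution of tame data at Bombieri–Vinogradov uniformity, Harper2016 /
LagariasSoundararajan2011 / de la Bretèche 1999 — is research-level analytic number theory, typed but
not provable in the tree today).  Also recorded: the
unconditional corollary `no_nearResidueFree_itr` in the crux's own vocabulary — a witness of
`TameLocalReceptacle` must use the unit residues `a′, b′, c′ mod p` in an UNBOUNDED way.
-/

-- `Summit.<Summit>.<Problem>` is the mandated summit-side namespace (CONVENTIONS §2); for the
-- single-conjunct summit `ABC` the two coincide, so the duplicate `ABC.ABC` is deliberate.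
set_option linter.dupNamespace false

namespace Summit.ABC.ABC.Theorems.TameLocalReceptacle

open Literature.NumberTheory.DiophantineGeometry
open Summit.ABC.ABC.Theses.CongruentialReceptacle

/-- Window consistency forces `c₁' > 0` once `c₁ > 0` and `ε ≤ 1` (evaluate both windows at `p = 2`,
`i + j + k = 4`). [folklore] -/
theorem c₁'_pos_of_inWindow {ε c₁ c₁' : ℝ} (hε : ε ≤ 1) (hc₁ : 0 < c₁) {t : Table}
    (hw : InWindow ε c₁ c₁' t) : 0 < c₁' := by
  have h := hw 2 4 0 0 0 0 0 Nat.prime_two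
  have hlog : 0 < Real.log (2 : ℕ) := by
    rw [Nat.cast_ofNat]; exact Real.log_pos (by norm_num)
  obtain ⟨hlo, hhi⟩ := h
  have habs : (t 2 4 0 0 0 0 0 : ℝ) ≤ |(t 2 4 0 0 0 0 0 : ℝ)| := le_abs_self _
  have h5 : (((4 + 0 + 0 : ℕ) : ℝ) + 1) = 5 := by norm_num
  have h2 : (2 * ((4 + 0 + 0 : ℕ) : ℝ) - 6 - ε) ≥ 1 := by push_cast; linarith
  rw [h5] at hhi
  have hpos : 0 < c₁ * (2 * ((4 + 0 + 0 : ℕ) : ℝ) - 6 - ε) * Real.log (2 : ℕ) := by positivity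
  nlinarith

/-- **No near-residue-free receptacle** (UNCONDITIONAL, in the crux's vocabulary): the single-table
receptacle cannot be witnessed at `κ = 2⁻²⁵`, `ε = 1` by a windowed table that is residue-free up to a
bounded perturbation `K` on occurring data — every witness of `TameLocalReceptacle` must use the unit
residues unboundedly.  Corollary of `stub_false_of_nearResidueFree` (only the lower window is used).
[folklore] -/
theorem no_nearResidueFree_itr (K : ℝ) :
    ¬ ∃ c₁ c₁' c₃ : ℝ, 0 < c₁ ∧ ∃ t : Table, InWindow 1 c₁ c₁' t ∧
      (∀ a b c : ℕ, IsBalanced (1 / 2 ^ 25) a b c → |(recSum t a b c : ℝ)| ≤ c₃) ∧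
      NearResidueFree (1 / 2 ^ 25) K t := by
  rintro ⟨c₁, c₁', c₃, hc₁, t, hw, hB, hN⟩
  exact stub_false_of_nearResidueFree le_rfl (by norm_num) hc₁ t (fun p i j k r s z hp =>
    (hw p i j k r s z hp).1) (fun a b c h => hB a b c h) hN

/-- **EH, the hypothesis of the negative lemma** (`H` of `--negative-modulo`): the ternary-smooth
residue-pinning hypothesis `PinningFamilies` of the line at balance `κ = 2⁻²⁵` for SOME absolute
discrepancy `A` — for any prime `p` and two data at `p` with the same exponents that both occur on the
`2⁻²⁵`-cell there are finite nonempty families of `2⁻²⁵`-balanced abc-triples carrying these data at `p`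
whose away-from-`p` means of every window-bounded real weight agree within `A` (intended witnesses:
`X^{1/3}`-smooth balanced triples conditioned at `p`, counted by the friable circle method — Harper 2016
Cor. 1, Lagarias–Soundararajan 2011/2012, de la Bretèche 1999 — at Bombieri–Vinogradov uniformity in the
data prime).  Research-level and unproved; NOT a published theorem, hence a hypothesis, not a fact. -/
def PinningHypothesis : Prop := ∃ A : ℝ, PinningFamilies (1 / 2 ^ 25) A

/-- **The crux is false modulo EH** (negative lemma `TameLocalReceptacle_false_of_PinningHypothesis`,
the composition of the checked skeleton of line `SketchIdeator1` with every stub but EH landed): the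
ternary-smooth residue-pinning hypothesis at balance `2⁻²⁵` refutes
`Summit.ABC.ABC.Theses.CongruentialReceptacle.TameLocalReceptacle` — transfer to the single table
(`stub_tlr_iff_itr`, read at `κ = 2⁻²⁵`, `ε = 1`), pinning (`stub_nearResidueFree_of_pinning`), and the
unconditional certificate (`stub_false_of_nearResidueFree`). [folklore] -/
theorem TameLocalReceptacle_false_of_PinningHypothesis :
    PinningHypothesis → ¬ TameLocalReceptacle := by
  rintro ⟨A, hE⟩ h
  obtain ⟨c₁, c₁', c₃, hc₁, t, hw, hB⟩ := stub_tlr_iff_itr.mp h (1 / 2 ^ 25) (by norm_num) 1 one_pos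
  have hc₁' : 0 < c₁' := c₁'_pos_of_inWindow le_rfl hc₁ hw
  exact stub_false_of_nearResidueFree le_rfl (by norm_num) hc₁ t (fun p i j k r s z hp =>
    (hw p i j k r s z hp).1) (fun a b c h => hB a b c h) (stub_nearResidueFree_of_pinning hc₁' t hw hB hE)

end Summit.ABC.ABC.Theorems.TameLocalReceptacle
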